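import Mathlib.MeasureTheory.Integral.IntervalIntegral.FundThmCalculus
import Mathlib.Analysis.SpecialFunctions.Integrals.Basic
import Mathlib.Analysis.SpecialFunctions.ImproperIntegrals
import Mathlib.Tactic.Module
import HarnessLib

/-!
# The Euler–Volterra equations of the Lorentz limit (`ℓ = 0, 1`) and the dipole log-modulus
# (helpers `t12_euler_dipole_logModulus`, `t12_euler_zonal_quadraticPlusLinear` of the line `birth`,
# crux `TwoClocks.EquilibriumFastWindowLD`, stmt-AtomisticToContinuum-14440; the real-analysis core of
# items T2 and T1-in-`ℓ ≤ 1` of the registered sub-goal `t12_logLinearPreimage_and_dipoleModulus`)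

The corrector transfer of the line `birth` needs the growth and the radial modulus of the orthogonal
pre-image `ψ` of quadratic data under the linearised hard-sphere operator `L = -ν + K₂ - K₁` of `ℝ³`
(`M`-weighted picture). After the sector decomposition (files `…T12ZonalComm*`, `…T12DipoleComm*`)
the zonal profile `f(|v|) = Π₀ψ(v)` and the dipole profile `Φ` (`Π₁ψ(v) = ⟪Φ(|v|), v⟫`,
`dipoleProfile ψ`) satisfy one-dimensional equations whose FAR-FIELD ("Lorentz") limit is explicit:
at large speed `s = |v|` the Maxwellian partner is at rest, the gain term acts on `|v|^α Y_ℓ` by the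
indicial multipliers `λ₀(α) = 4/(α+2)`, `λ₁(α) = 4/(α+3)` (file `…T12Indicial`), i.e. by the Volterra
operators `f ↦ (4/s²) ∫₀ˢ t f(t) dt` (`ℓ = 0`) and `Φ ↦ (4/s⁴) ∫₀ˢ t³ Φ(t) dt` (`ℓ = 1`), and
`ν(s) = πs (1 + O(s⁻²))`. Dividing the sector equations by `ν` and moving every thermal correction to
the right-hand side one obtains the EULER–VOLTERRA EQUATIONS OF THE LORENTZ LIMIT

  `ℓ = 1`:  `Φ(s) = (4/s⁴) ∫₀ˢ t³ Φ(t) dt - γ(s)`,       `‖γ(s)‖ ≤ Γ`            (`s ≥ s₀`),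
  `ℓ = 0`:  `f(s) = (4/s²) ∫₀ˢ t f(t) dt - (a s + δ(s))`,  `|δ(s)| ≤ Γ`            (`s ≥ s₀`),

(the `ℓ = 0` right side is linear plus bounded because quadratic data divided by `ν ~ πs` are linear).
Both are solved in closed form by one differentiation of an Euler quotient, and this file proves the
consequences as stand-alone theorems of real analysis (no Boltzmann objects; `Φ` with values in any
complete real normed space, in particular `ℝ³` and `ℝ`):

* `hasDerivAt_euler_dipole`, `euler_dipole_quotient_sub`, `euler_dipole_sub_eq` — with
  `Ψ := ∫₀ t³Φ`: `(Ψ/s⁴)' = s⁻¹(Φ - 4Ψ/s⁴) = -γ/s`, hence the REPRESENTATION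
  `Φ(S) - Φ(r) = -4 ∫ᵣ^S γ(u) du/u - (γ(S) - γ(r))` (`s₀ ≤ r ≤ S`);
* `euler_dipole_logModulus` and the **registered helper `t12_euler_dipole_logModulus`** (its `ℝ³`
  instance) — (E1b) THE LOG-MODULUS **`‖Φ(r) - Φ(S)‖ ≤ 4Γ log(S/r) + 2Γ`** (`s₀ ≤ r ≤ S`): this is
  T2 of the sub-goal once the kinetic estimates (e-ν), (e-K₁), (e-K₂) of the plan bound `γ`;
* `euler_dipole_norm_le` — (E1a) the LOG GROWTH `‖Φ(s)‖ ≤ 4‖Ψ(s₀)‖/s₀⁴ + 4Γ log(s/s₀) + Γ`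
  (T1 in the sector `ℓ = 1`: `|Π₁ψ(v)| ≲ |v| (1 + log|v|)` — the `ℓ = 1` log-resonance is sharp);
* `hasDerivAt_euler_zonal` and the **registered helper `t12_euler_zonal_quadraticPlusLinear`** —
  (E0) with `F := ∫₀ t f`: `(F/s⁴ - a/s)' = -δ/s³`, hence `F(s)/s⁴ = a/s + q/4 + ∫ₛ^∞ δ/t³` and
  **`|f(s) - q s² - 3a s| ≤ 3Γ`** for `s ≥ s₀`, with the explicit leading coefficient
  `q = 4(F(s₀)/s₀⁴ - a/s₀ - ∫_{s₀}^∞ δ/t³)`, `|q - 4(F(s₀)/s₀⁴ - a/s₀)| ≤ 2Γ/s₀²` (T1 in `ℓ = 0`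
  after the shift by the energy invariant `-q(|v|² - 3)`: the zonal part is `3a|v| + O(Γ)`).

Hypotheses are the minimal ones the consumers have: `Φ`, `f` continuous on `(0, ∞)` (the profiles of
a continuous `ψ`; `dipoleProfile ψ` is `continuousOn_dipoleProfile`), the Volterra densities `t³Φ(t)`,
`t f(t)` interval-integrable on `[0, s₀]` (the junk near the origin enters only through `Ψ(s₀)`,
`F(s₀)`), and the identities on `[s₀, ∞)`; `γ`, `δ` need not be measurable (on `[s₀, ∞)` they are
continuous combinations of `Φ, Ψ` resp. `f, F`). Tools: FTC-1 `intervalIntegral.integral_hasDerivAt_right`,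
FTC-2 `integral_eq_sub_of_hasDerivAt`, `integral_inv_of_pos`, the improper tail `integral_Ioi_rpow_of_lt`
and `intervalIntegral.integral_Ioi_sub_Ioi`. NOT here: the derivation of the two equations from `L`
(smeared Volterra kernels (e-K₂), rates (e-ν), (e-K₁) — plan §5 of the crux note
`Summits/AtomisticToContinuum/HydrodynamicLimit/Cruxes/EquilibriumFastWindowLD/CorrectorLogResonance.md`),
and the small-speed region `s < s₀`. All statements are [folklore] (Euler equations; Grad 1963 §4 and
Cercignani–Illner–Pulvirenti 1994 §7.2 for the far-field form of `ν` and `K`).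
-/

noncomputable section

open MeasureTheory Real Set Filter intervalIntegral
open scoped ENNReal BigOperators Topology

namespace Summit.AtomisticToContinuum.HydrodynamicLimit.Theorems.ClampedCorrectorBirth

/-! ### `ℓ = 1`: the dipole sector -/

section Dipole

variable {E : Type*} [NormedAddCommGroup E] [NormedSpace ℝ E] [CompleteSpace E]

omit [CompleteSpace E] in
/-- The Volterra density `t ↦ t³ Φ(t)` of the dipole sector is integrable on `[0, s]` for every
`s ≥ s₀` as soon as it is on `[0, s₀]` and `Φ` is continuous on `(0, ∞)`. [folklore] -/
theorem intervalIntegrable_cube_smul_of_le {Φ : ℝ → E} {s₀ s : ℝ} (hs₀ : 0 < s₀) (hs : s₀ ≤ s)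
    (hΦ : ContinuousOn Φ (Ioi 0)) (hint : IntervalIntegrable (fun t => t ^ 3 • Φ t) volume 0 s₀) :
    IntervalIntegrable (fun t => t ^ 3 • Φ t) volume 0 s := by
  refine hint.trans (ContinuousOn.intervalIntegrable ?_)
  have hsub : uIcc s₀ s ⊆ Ioi 0 := by
    rw [uIcc_of_le hs]
    exact fun t ht => hs₀.trans_le ht.1
  exact (((continuous_pow 3).continuousOn).smul hΦ).mono hsub

/-- FTC-1 for the cube moment `Ψ(u) = ∫₀ᵘ t³ Φ(t) dt`: `Ψ'(s) = s³ Φ(s)` at every `s ≥ s₀ > 0`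
(`Φ` continuous on `(0, ∞)`). [folklore] -/
theorem hasDerivAt_cubeMoment {Φ : ℝ → E} {s₀ s : ℝ} (hs₀ : 0 < s₀) (hs : s₀ ≤ s)
    (hΦ : ContinuousOn Φ (Ioi 0)) (hint : IntervalIntegrable (fun t => t ^ 3 • Φ t) volume 0 s₀) :
    HasDerivAt (fun u => ∫ t in (0:ℝ)..u, t ^ 3 • Φ t) (s ^ 3 • Φ s) s := by
  have hs' : 0 < s := hs₀.trans_le hs
  have hg : ContinuousOn (fun t : ℝ => t ^ 3 • Φ t) (Ioi 0) :=
    ((continuous_pow 3).continuousOn).smul hΦ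
  exact integral_hasDerivAt_right (intervalIntegrable_cube_smul_of_le hs₀ hs hΦ hint)
    (hg.stronglyMeasurableAtFilter isOpen_Ioi s hs') (hg.continuousAt (Ioi_mem_nhds hs'))

/-- **The Euler quotient of the dipole sector.** With `Ψ(u) = ∫₀ᵘ t³ Φ(t) dt`:
`(Ψ/u⁴)'(s) = Ψ'(s)/s⁴ - 4Ψ(s)/s⁵ = s⁻¹ (Φ(s) - (4/s⁴) Ψ(s))` at every `s ≥ s₀ > 0`; along a solution of
the `ℓ = 1` Euler–Volterra equation `Φ = (4/s⁴)Ψ - γ` this is `-γ(s)/s`. [folklore] -/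
theorem hasDerivAt_euler_dipole {Φ : ℝ → E} {s₀ s : ℝ} (hs₀ : 0 < s₀) (hs : s₀ ≤ s)
    (hΦ : ContinuousOn Φ (Ioi 0)) (hint : IntervalIntegrable (fun t => t ^ 3 • Φ t) volume 0 s₀) :
    HasDerivAt (fun u => (u ^ 4)⁻¹ • ∫ t in (0:ℝ)..u, t ^ 3 • Φ t)
      (s⁻¹ • (Φ s - (4 / s ^ 4) • ∫ t in (0:ℝ)..s, t ^ 3 • Φ t)) s := by
  have hs' : 0 < s := hs₀.trans_le hs
  have hΨ := hasDerivAt_cubeMoment hs₀ hs hΦ hint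
  have hinv : HasDerivAt (fun u : ℝ => (u ^ 4)⁻¹) (-(4 * s ^ 3) / (s ^ 4) ^ 2) s :=
    ((hasDerivAt_pow 4 s).fun_inv (pow_ne_zero 4 hs'.ne')).congr_deriv (by norm_num)
  refine (hinv.fun_smul hΨ).congr_deriv ?_
  have h4 : s ^ 4 ≠ 0 := pow_ne_zero 4 hs'.ne'
  match_scalars <;> field_simp

/-- **Integrated Euler quotient**: for `s₀ ≤ r ≤ S`,
`Ψ(S)/S⁴ - Ψ(r)/r⁴ = ∫ᵣ^S u⁻¹ (Φ(u) - (4/u⁴) Ψ(u)) du` (FTC-2; the derivative is continuous on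
`[r, S]`). [folklore] -/
theorem euler_dipole_quotient_sub {Φ : ℝ → E} {s₀ r S : ℝ} (hs₀ : 0 < s₀) (hr : s₀ ≤ r)
    (hrS : r ≤ S) (hΦ : ContinuousOn Φ (Ioi 0))
    (hint : IntervalIntegrable (fun t => t ^ 3 • Φ t) volume 0 s₀) :
    (S ^ 4)⁻¹ • (∫ t in (0:ℝ)..S, t ^ 3 • Φ t) - (r ^ 4)⁻¹ • (∫ t in (0:ℝ)..r, t ^ 3 • Φ t) =
      ∫ u in r..S, u⁻¹ • (Φ u - (4 / u ^ 4) • ∫ t in (0:ℝ)..u, t ^ 3 • Φ t) := by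
  have hd : ∀ u ∈ uIcc r S, HasDerivAt (fun u => (u ^ 4)⁻¹ • ∫ t in (0:ℝ)..u, t ^ 3 • Φ t)
      (u⁻¹ • (Φ u - (4 / u ^ 4) • ∫ t in (0:ℝ)..u, t ^ 3 • Φ t)) u := fun u hu => by
    rw [uIcc_of_le hrS] at hu
    exact hasDerivAt_euler_dipole hs₀ (hr.trans hu.1) hΦ hint
  have hcont : ContinuousOn (fun u => u⁻¹ • (Φ u - (4 / u ^ 4) • ∫ t in (0:ℝ)..u, t ^ 3 • Φ t))
      (uIcc r S) := by
    rw [uIcc_of_le hrS]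
    intro u hu
    have hu₀ : s₀ ≤ u := hr.trans hu.1
    have hu0 : 0 < u := hs₀.trans_le hu₀
    have h1 : ContinuousAt (fun u : ℝ => u⁻¹) u := continuousAt_inv₀ hu0.ne'
    have h2 : ContinuousAt Φ u := hΦ.continuousAt (Ioi_mem_nhds hu0)
    have h3 : ContinuousAt (fun u : ℝ => 4 / u ^ 4) u :=
      continuousAt_const.div (continuousAt_pow _ _) (pow_ne_zero 4 hu0.ne')
    have h4 : ContinuousAt (fun u => ∫ t in (0:ℝ)..u, t ^ 3 • Φ t) u :=
      (hasDerivAt_cubeMoment hs₀ hu₀ hΦ hint).continuousAt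
    exact (h1.smul (h2.sub (h3.smul h4))).continuousWithinAt
  rw [integral_eq_sub_of_hasDerivAt hd (hcont.intervalIntegrable)]

/-- **Representation of the solutions of the `ℓ = 1` Euler–Volterra equation.** If `Φ` is continuous
on `(0, ∞)`, `t³ Φ` is integrable on `[0, s₀]`, and `Φ(s) = (4/s⁴) ∫₀ˢ t³ Φ(t) dt - γ(s)` for all
`s ≥ s₀ > 0`, then for `s₀ ≤ r ≤ S`:
`Φ(S) - Φ(r) = -4 ∫ᵣ^S γ(u) du/u - (γ(S) - γ(r))`
(with `Ψ = ∫₀ t³Φ`: `Ψ' = s³Φ = s³(4Ψ/s⁴ - γ)`, so `(Ψ/s⁴)' = -γ/s`, and `Φ = 4Ψ/s⁴ - γ`). [folklore] -/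
theorem euler_dipole_sub_eq {Φ γ : ℝ → E} {s₀ : ℝ} (hs₀ : 0 < s₀) (hΦ : ContinuousOn Φ (Ioi 0))
    (hint : IntervalIntegrable (fun t => t ^ 3 • Φ t) volume 0 s₀)
    (hE : ∀ s, s₀ ≤ s → Φ s = (4 / s ^ 4) • (∫ t in (0:ℝ)..s, t ^ 3 • Φ t) - γ s)
    {r S : ℝ} (hr : s₀ ≤ r) (hrS : r ≤ S) :
    Φ S - Φ r = -((4:ℝ) • ∫ u in r..S, u⁻¹ • γ u) - (γ S - γ r) := by
  have hq := euler_dipole_quotient_sub hs₀ hr hrS hΦ hint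
  have hcongr : ∫ u in r..S, u⁻¹ • (Φ u - (4 / u ^ 4) • ∫ t in (0:ℝ)..u, t ^ 3 • Φ t) =
      ∫ u in r..S, -(u⁻¹ • γ u) := by
    refine integral_congr fun u hu => ?_
    rw [uIcc_of_le hrS] at hu
    simp only [hE u (hr.trans hu.1), sub_sub_cancel_left, smul_neg]
  rw [hcongr, intervalIntegral.integral_neg] at hq
  have hq' : ∫ u in r..S, u⁻¹ • γ u =
      -((S ^ 4)⁻¹ • (∫ t in (0:ℝ)..S, t ^ 3 • Φ t) - (r ^ 4)⁻¹ • (∫ t in (0:ℝ)..r, t ^ 3 • Φ t)) := by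
    rw [hq, neg_neg]
  rw [hE S (hr.trans hrS), hE r hr, hq']
  module

omit [CompleteSpace E] in
/-- **The radial integral of the log-modulus**: `‖∫ᵣ^S γ(u) du/u‖ ≤ Γ log(S/r)` for `0 < r ≤ S` and
`‖γ‖ ≤ Γ` on `[r, S]`. [folklore] -/
theorem norm_integral_inv_smul_le {γ : ℝ → E} {Γ r S : ℝ} (hr : 0 < r) (hrS : r ≤ S)
    (hγ : ∀ u, r ≤ u → u ≤ S → ‖γ u‖ ≤ Γ) :
    ‖∫ u in r..S, u⁻¹ • γ u‖ ≤ Γ * Real.log (S / r) := by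
  have hii : IntervalIntegrable (fun u : ℝ => Γ * u⁻¹) volume r S := by
    refine (intervalIntegrable_inv (fun u hu => ?_) continuousOn_id).const_mul Γ
    rw [uIcc_of_le hrS] at hu
    exact (hr.trans_le hu.1).ne'
  calc ‖∫ u in r..S, u⁻¹ • γ u‖ ≤ ∫ u in r..S, Γ * u⁻¹ := by
        refine norm_integral_le_of_norm_le hrS (ae_of_all _ fun u hu => ?_) hii
        have hu0 : 0 < u := hr.trans hu.1
        rw [norm_smul, norm_inv, Real.norm_of_nonneg hu0.le, mul_comm]
        exact mul_le_mul_of_nonneg_right (hγ u hu.1.le hu.2) (inv_nonneg.2 hu0.le)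
    _ = Γ * Real.log (S / r) := by
        rw [intervalIntegral.integral_const_mul, integral_inv_of_pos hr (hr.trans_le hrS)]

/-- **(E1b) The dipole log-modulus, general normed space.** A solution of the `ℓ = 1` Euler–Volterra
equation `Φ(s) = (4/s⁴) ∫₀ˢ t³ Φ(t) dt - γ(s)` (`s ≥ s₀ > 0`) with bounded right side `‖γ‖ ≤ Γ` on
`[s₀, ∞)` has the LOG-MODULUS `‖Φ(r) - Φ(S)‖ ≤ 4Γ log(S/r) + 2Γ` for `s₀ ≤ r ≤ S`. [folklore] -/
theorem euler_dipole_logModulus {Φ γ : ℝ → E} {Γ s₀ : ℝ} (hs₀ : 0 < s₀) (hΦ : ContinuousOn Φ (Ioi 0))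
    (hint : IntervalIntegrable (fun t => t ^ 3 • Φ t) volume 0 s₀) (hγ : ∀ s, s₀ ≤ s → ‖γ s‖ ≤ Γ)
    (hE : ∀ s, s₀ ≤ s → Φ s = (4 / s ^ 4) • (∫ t in (0:ℝ)..s, t ^ 3 • Φ t) - γ s)
    {r S : ℝ} (hr : s₀ ≤ r) (hrS : r ≤ S) :
    ‖Φ r - Φ S‖ ≤ 4 * Γ * Real.log (S / r) + 2 * Γ := by
  have hr0 : 0 < r := hs₀.trans_le hr
  have hI := norm_integral_inv_smul_le (γ := γ) (Γ := Γ) hr0 hrS fun u hu _ => hγ u (hr.trans hu)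
  rw [norm_sub_rev, euler_dipole_sub_eq hs₀ hΦ hint hE hr hrS]
  calc ‖-((4:ℝ) • ∫ u in r..S, u⁻¹ • γ u) - (γ S - γ r)‖
        ≤ ‖-((4:ℝ) • ∫ u in r..S, u⁻¹ • γ u)‖ + ‖γ S - γ r‖ := norm_sub_le _ _
    _ ≤ 4 * ‖∫ u in r..S, u⁻¹ • γ u‖ + (‖γ S‖ + ‖γ r‖) := by
        rw [norm_neg, norm_smul, Real.norm_of_nonneg (by norm_num : (0:ℝ) ≤ 4)]
        exact add_le_add le_rfl (norm_sub_le (γ S) (γ r))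
    _ ≤ 4 * (Γ * Real.log (S / r)) + (Γ + Γ) := by
        gcongr
        · exact hγ S (hr.trans hrS)
        · exact hγ r hr
    _ = 4 * Γ * Real.log (S / r) + 2 * Γ := by ring

/-- **(E1a) Logarithmic growth in the dipole sector, general normed space**: under the hypotheses of
`euler_dipole_logModulus`, `‖Φ(s)‖ ≤ 4 ‖Ψ(s₀)‖/s₀⁴ + 4Γ log(s/s₀) + Γ` for `s ≥ s₀`, where
`Ψ(s₀) = ∫₀^{s₀} t³ Φ(t) dt` (`Φ(s) = 4Ψ(s₀)/s₀⁴ - 4∫_{s₀}^s γ(u)du/u - γ(s)`). [folklore] -/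
theorem euler_dipole_norm_le {Φ γ : ℝ → E} {Γ s₀ : ℝ} (hs₀ : 0 < s₀) (hΦ : ContinuousOn Φ (Ioi 0))
    (hint : IntervalIntegrable (fun t => t ^ 3 • Φ t) volume 0 s₀) (hγ : ∀ s, s₀ ≤ s → ‖γ s‖ ≤ Γ)
    (hE : ∀ s, s₀ ≤ s → Φ s = (4 / s ^ 4) • (∫ t in (0:ℝ)..s, t ^ 3 • Φ t) - γ s)
    {s : ℝ} (hs : s₀ ≤ s) :
    ‖Φ s‖ ≤ 4 * ‖∫ t in (0:ℝ)..s₀, t ^ 3 • Φ t‖ / s₀ ^ 4 + 4 * Γ * Real.log (s / s₀) + Γ := by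
  have hI := norm_integral_inv_smul_le (γ := γ) (Γ := Γ) hs₀ hs fun u hu _ => hγ u hu
  have hrep : Φ s = (4 / s₀ ^ 4) • (∫ t in (0:ℝ)..s₀, t ^ 3 • Φ t)
      - (4:ℝ) • (∫ u in s₀..s, u⁻¹ • γ u) - γ s := by
    have h := euler_dipole_sub_eq hs₀ hΦ hint hE le_rfl hs
    rw [hE s₀ le_rfl, sub_eq_iff_eq_add] at h
    rw [h]
    module
  rw [hrep]
  calc ‖(4 / s₀ ^ 4) • (∫ t in (0:ℝ)..s₀, t ^ 3 • Φ t) - (4:ℝ) • (∫ u in s₀..s, u⁻¹ • γ u) - γ s‖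
        ≤ ‖(4 / s₀ ^ 4) • (∫ t in (0:ℝ)..s₀, t ^ 3 • Φ t)‖ + ‖(4:ℝ) • (∫ u in s₀..s, u⁻¹ • γ u)‖
          + ‖γ s‖ := (norm_sub_le _ _).trans (add_le_add (norm_sub_le _ _) le_rfl)
    _ ≤ 4 * ‖∫ t in (0:ℝ)..s₀, t ^ 3 • Φ t‖ / s₀ ^ 4 + 4 * (Γ * Real.log (s / s₀)) + Γ := by
        rw [norm_smul, norm_smul, Real.norm_of_nonneg (by positivity : (0:ℝ) ≤ 4 / s₀ ^ 4),
          Real.norm_of_nonneg (by norm_num : (0:ℝ) ≤ 4), div_mul_eq_mul_div]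
        gcongr
        exact hγ s hs
    _ = _ := by ring

end Dipole

/-- **Registered helper `t12_euler_dipole_logModulus` (E1b = the core of T2).** The `ℓ = 1` (dipole)
profile `Φ : (0, ∞) → ℝ³` of the corrector solves, in the far field, the Euler–Volterra equation of
the Lorentz-limit linearised hard-sphere operator in the `ℓ = 1` sector,
`Φ(s) = (4/s⁴) ∫₀ˢ t³ Φ(t) dt - γ(s)` for `s ≥ s₀`, with a BOUNDED right side `‖γ‖ ≤ Γ`.
Consequence (pure real analysis): the log-modulus **`‖Φ(r) - Φ(S)‖ ≤ 4Γ log(S/r) + 2Γ`** for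
`s₀ ≤ r ≤ S`. Proof: `Ψ := ∫₀ t³Φ` has `(Ψ/s⁴)' = -γ/s`, `Φ = 4Ψ/s⁴ - γ`, so
`Φ(S) - Φ(r) = -4∫ᵣ^S γ du/u - (γ(S) - γ(r))`. Hypotheses: `Φ` continuous on `(0, ∞)` and `t³Φ(t)`
integrable on `[0, s₀]` (the junk near the origin only enters through `Ψ(s₀)`). [folklore] -/
theorem t12_euler_dipole_logModulus : ∀ (Φ γ : ℝ → EuclideanSpace ℝ (Fin 3)) (Γ s₀ : ℝ), 0 < s₀ → ContinuousOn Φ (Set.Ioi 0) → IntervalIntegrable (fun t => t ^ 3 • Φ t) MeasureTheory.volume 0 s₀ → (∀ s, s₀ ≤ s → ‖γ s‖ ≤ Γ) → (∀ s, s₀ ≤ s → Φ s = (4 / s ^ 4) • (∫ t in (0:ℝ)..s, t ^ 3 • Φ t) - γ s) → ∀ r S : ℝ, s₀ ≤ r → r ≤ S → ‖Φ r - Φ S‖ ≤ 4 * Γ * Real.log (S / r) + 2 * Γ :=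
  fun _ _ _ _ hs₀ hΦ hint hγ hE _ _ hr hrS => euler_dipole_logModulus hs₀ hΦ hint hγ hE hr hrS

/-! ### `ℓ = 0`: the zonal sector -/

/-- FTC-1 for the first moment `F(u) = ∫₀ᵘ t f(t) dt`: `F'(s) = s f(s)` at every `s ≥ s₀ > 0`
(`f` continuous on `(0, ∞)`, `t f(t)` integrable on `[0, s₀]`). [folklore] -/
theorem hasDerivAt_firstMoment {f : ℝ → ℝ} {s₀ s : ℝ} (hs₀ : 0 < s₀) (hs : s₀ ≤ s)
    (hf : ContinuousOn f (Ioi 0)) (hint : IntervalIntegrable (fun t => t * f t) volume 0 s₀) :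
    HasDerivAt (fun u => ∫ t in (0:ℝ)..u, t * f t) (s * f s) s := by
  have hs' : 0 < s := hs₀.trans_le hs
  have hg : ContinuousOn (fun t : ℝ => t * f t) (Ioi 0) := continuousOn_id.mul hf
  have hgi : IntervalIntegrable (fun t => t * f t) volume 0 s := by
    refine hint.trans (ContinuousOn.intervalIntegrable (hg.mono ?_))
    rw [uIcc_of_le hs]
    exact fun t ht => hs₀.trans_le ht.1
  exact integral_hasDerivAt_right hgi (hg.stronglyMeasurableAtFilter isOpen_Ioi s hs')
    (hg.continuousAt (Ioi_mem_nhds hs'))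

/-- **The Euler quotient of the zonal sector.** With `F(u) = ∫₀ᵘ t f(t) dt` and the defect
`δ'(u) := (4/u²) F(u) - f(u) - a u` of the `ℓ = 0` Euler–Volterra equation:
`(F/u⁴ - a/u)'(s) = -δ'(s)/s³` at every `s ≥ s₀ > 0`
(`(F/u⁴)' = F'/u⁴ - 4F/u⁵ = (f - 4F/u²)/u³ = -(a u + δ')/u³`). [folklore] -/
theorem hasDerivAt_euler_zonal {f : ℝ → ℝ} {s₀ s : ℝ} (a : ℝ) (hs₀ : 0 < s₀) (hs : s₀ ≤ s)
    (hf : ContinuousOn f (Ioi 0)) (hint : IntervalIntegrable (fun t => t * f t) volume 0 s₀) :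
    HasDerivAt (fun u => (∫ t in (0:ℝ)..u, t * f t) / u ^ 4 - a / u)
      (-((4 / s ^ 2 * (∫ t in (0:ℝ)..s, t * f t) - f s - a * s) / s ^ 3)) s := by
  have hs' : 0 < s := hs₀.trans_le hs
  have hF := hasDerivAt_firstMoment hs₀ hs hf hint
  have h1 := hF.fun_div (hasDerivAt_pow 4 s) (pow_ne_zero 4 hs'.ne')
  have h2 := (hasDerivAt_const s a).fun_div (hasDerivAt_id' s) hs'.ne'
  refine (h1.sub h2).congr_deriv ?_
  have hs0 : s ≠ 0 := hs'.ne'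
  push_cast
  field_simp
  ring

/-- **Registered helper `t12_euler_zonal_quadraticPlusLinear` (E0 = T1 in the sector `ℓ = 0`).**
The `ℓ = 0` (zonal) profile `f` of the corrector solves, in the far field, the Euler–Volterra
equation of the Lorentz-limit linearised hard-sphere operator in the `ℓ = 0` sector,
`f(s) = (4/s²) ∫₀ˢ t f(t) dt - γ₀(s)` for `s ≥ s₀ > 0`, whose right side is LINEAR PLUS BOUNDED,
`γ₀(s) = a s + δ(s)`, `|δ| ≤ Γ`. Consequence (pure real analysis): **`f(s) = q s² + 3a s + O(Γ)`**
with the sharp remainder `|f(s) - q s² - 3a s| ≤ 3Γ` (`s ≥ s₀`) and the explicit leading coefficient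
`q = 4 (F(s₀)/s₀⁴ - a/s₀ - ∫_{s₀}^∞ δ(t) dt/t³)`, `F(s₀) = ∫₀^{s₀} t f`, pinned here by
`|q - 4(F(s₀)/s₀⁴ - a/s₀)| ≤ 2Γ/s₀²`. (`q s²` is the energy invariant; after the shift by `-q(|v|² - 3)`
the zonal part of the corrector is `O(|v|)`: T1 in `ℓ = 0`.) Proof: `(F/s⁴ - a/s)' = -δ/s³`, so
`F(s)/s⁴ = a/s + q/4 + ∫ₛ^∞ δ/t³`, and `f = 4F/s² - a s - δ = q s² + 3a s + 4s² ∫ₛ^∞ δ/t³ - δ` with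
`|4 s² ∫ₛ^∞ δ/t³| ≤ 2Γ`. [folklore] -/
theorem t12_euler_zonal_quadraticPlusLinear : ∀ (f δ : ℝ → ℝ) (a Γ s₀ : ℝ), 0 < s₀ → ContinuousOn f (Set.Ioi 0) → IntervalIntegrable (fun t => t * f t) MeasureTheory.volume 0 s₀ → (∀ s, s₀ ≤ s → |δ s| ≤ Γ) → (∀ s, s₀ ≤ s → f s = 4 / s ^ 2 * (∫ t in (0:ℝ)..s, t * f t) - (a * s + δ s)) → ∃ q : ℝ, |q - 4 * ((∫ t in (0:ℝ)..s₀, t * f t) / s₀ ^ 4 - a / s₀)| ≤ 2 * Γ / s₀ ^ 2 ∧ ∀ s, s₀ ≤ s → |f s - q * s ^ 2 - 3 * a * s| ≤ 3 * Γ := by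
  intro f δ a Γ s₀ hs₀ hf hint hδ hE
  -- the first moment and the (continuous) defect
  set F : ℝ → ℝ := fun u => ∫ t in (0:ℝ)..u, t * f t with hF
  set δ' : ℝ → ℝ := fun u => 4 / u ^ 2 * F u - f u - a * u with hδ'
  have hδδ : ∀ u, s₀ ≤ u → δ' u = δ u := fun u hu => by
    simp only [hδ', hF, hE u hu]
    ring
  have hΓ : 0 ≤ Γ := (abs_nonneg _).trans (hδ s₀ le_rfl)
  -- continuity of the defect on `[s₀, ∞)`
  have hδ'c : ∀ u, s₀ ≤ u → ContinuousAt (fun u => δ' u / u ^ 3) u := fun u hu => by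
    have hu0 : 0 < u := hs₀.trans_le hu
    have h1 : ContinuousAt (fun u : ℝ => 4 / u ^ 2) u :=
      continuousAt_const.div (continuousAt_pow _ _) (pow_ne_zero 2 hu0.ne')
    have h2 : ContinuousAt F u := (hasDerivAt_firstMoment hs₀ hu hf hint).continuousAt
    have h3 : ContinuousAt f u := hf.continuousAt (Ioi_mem_nhds hu0)
    have h4 : ContinuousAt (fun u : ℝ => a * u) u := (continuous_const.mul continuous_id).continuousAt
    exact (((h1.mul h2).sub h3).sub h4).div (continuousAt_pow _ _) (pow_ne_zero 3 hu0.ne')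
  have hδ'co : ContinuousOn (fun u => δ' u / u ^ 3) (Ici s₀) := fun u hu =>
    (hδ'c u hu).continuousWithinAt
  -- the tail integrals `∫_{(s, ∞)} δ'/t³`: integrability and the bound `Γ/(2 s²)`
  have hrpow : ∀ u : ℝ, 0 < u → u ^ (-3:ℝ) = (u ^ 3)⁻¹ := fun u hu => by
    rw [Real.rpow_neg hu.le, show (3:ℝ) = ((3:ℕ):ℝ) by norm_num, Real.rpow_natCast]
  have hdom : ∀ s, s₀ ≤ s → IntegrableOn (fun u : ℝ => Γ * u ^ (-3:ℝ)) (Ioi s) := fun s hs =>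
    ((integrableOn_Ioi_rpow_of_lt (by norm_num) (hs₀.trans_le hs)).const_mul Γ)
  have hbound : ∀ s, s₀ ≤ s → ∀ᵐ u ∂(volume.restrict (Ioi s)), ‖δ' u / u ^ 3‖ ≤ Γ * u ^ (-3:ℝ) := by
    intro s hs
    filter_upwards [ae_restrict_mem measurableSet_Ioi] with u hu
    have hu₀ : s₀ ≤ u := hs.trans (le_of_lt hu)
    have hu0 : 0 < u := hs₀.trans_le hu₀
    rw [hrpow u hu0, Real.norm_eq_abs, abs_div, abs_of_pos (pow_pos hu0 3), div_eq_mul_inv, hδδ u hu₀]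
    exact mul_le_mul_of_nonneg_right (hδ u hu₀) (inv_nonneg.2 (pow_pos hu0 3).le)
  have htail_int : ∀ s, s₀ ≤ s → IntegrableOn (fun u => δ' u / u ^ 3) (Ioi s) := fun s hs =>
    (hdom s hs).mono' ((hδ'co.mono fun u hu => hs.trans (le_of_lt hu)).aestronglyMeasurable
      measurableSet_Ioi) (hbound s hs)
  have htail : ∀ s, s₀ ≤ s → |∫ u in Ioi s, δ' u / u ^ 3| ≤ Γ / (2 * s ^ 2) := by
    intro s hs
    have hs' : 0 < s := hs₀.trans_le hs
    have h := norm_integral_le_of_norm_le (hdom s hs) (hbound s hs)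
    rw [Real.norm_eq_abs] at h
    refine h.trans (le_of_eq ?_)
    rw [MeasureTheory.integral_const_mul, integral_Ioi_rpow_of_lt (by norm_num) hs',
      show (-3:ℝ) + 1 = -2 by norm_num, Real.rpow_neg hs'.le,
      show (2:ℝ) = ((2:ℕ):ℝ) by norm_num, Real.rpow_natCast]
    have : s ^ 2 ≠ 0 := pow_ne_zero 2 hs'.ne'
    field_simp
  -- the Euler identity `F(s)/s⁴ - a/s - (F(s₀)/s₀⁴ - a/s₀) = -∫_{s₀}^s δ'/u³`
  have hW : ∀ s, s₀ ≤ s →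
      F s / s ^ 4 - a / s - (F s₀ / s₀ ^ 4 - a / s₀) = -∫ u in s₀..s, δ' u / u ^ 3 := by
    intro s hs
    have hd : ∀ u ∈ uIcc s₀ s, HasDerivAt (fun u => F u / u ^ 4 - a / u) (-(δ' u / u ^ 3)) u := by
      intro u hu
      rw [uIcc_of_le hs] at hu
      exact hasDerivAt_euler_zonal a hs₀ hu.1 hf hint
    have hi : IntervalIntegrable (fun u => -(δ' u / u ^ 3)) volume s₀ s := by
      refine (ContinuousOn.intervalIntegrable ?_).neg
      rw [uIcc_of_le hs]
      exact hδ'co.mono Icc_subset_Ici_self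
    rw [← intervalIntegral.integral_neg, integral_eq_sub_of_hasDerivAt hd hi]
  -- the leading coefficient
  set I : ℝ := ∫ u in Ioi s₀, δ' u / u ^ 3 with hI
  refine ⟨4 * (F s₀ / s₀ ^ 4 - a / s₀ - I), ?_, fun s hs => ?_⟩
  · have h := htail s₀ le_rfl
    rw [show 4 * (F s₀ / s₀ ^ 4 - a / s₀ - I) - 4 * (F s₀ / s₀ ^ 4 - a / s₀) = -4 * I by ring,
      abs_mul, abs_neg, show |(4:ℝ)| = 4 by norm_num]
    calc 4 * |I| ≤ 4 * (Γ / (2 * s₀ ^ 2)) := by gcongr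
      _ = 2 * Γ / s₀ ^ 2 := by ring
  · have hs' : 0 < s := hs₀.trans_le hs
    have hsplit : I - ∫ u in Ioi s, δ' u / u ^ 3 = ∫ u in s₀..s, δ' u / u ^ 3 :=
      integral_Ioi_sub_Ioi (htail_int s₀ le_rfl) hs
    set J : ℝ := ∫ u in Ioi s, δ' u / u ^ 3 with hJ
    have hFs : F s = (a / s + (F s₀ / s₀ ^ 4 - a / s₀) - (I - J)) * s ^ 4 := by
      rw [← div_eq_iff (pow_ne_zero 4 hs'.ne')]
      linarith [hW s hs]
    have key : f s - 4 * (F s₀ / s₀ ^ 4 - a / s₀ - I) * s ^ 2 - 3 * a * s = 4 * s ^ 2 * J - δ s := by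
      rw [hE s hs]
      change 4 / s ^ 2 * F s - (a * s + δ s) - 4 * (F s₀ / s₀ ^ 4 - a / s₀ - I) * s ^ 2 - 3 * a * s
        = 4 * s ^ 2 * J - δ s
      rw [hFs]
      have hs0 : s ≠ 0 := hs'.ne'
      field_simp
      ring
    rw [key]
    calc |4 * s ^ 2 * J - δ s| ≤ |4 * s ^ 2 * J| + |δ s| := abs_sub _ _
      _ = 4 * s ^ 2 * |J| + |δ s| := by rw [abs_mul, abs_of_pos (by positivity)]
      _ ≤ 4 * s ^ 2 * (Γ / (2 * s ^ 2)) + Γ := by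
          gcongr
          · exact htail s hs
          · exact hδ s hs
      _ = 3 * Γ := by
          have hs0 : s ^ 2 ≠ 0 := pow_ne_zero 2 hs'.ne'
          field_simp
          ring

end Summit.AtomisticToContinuum.HydrodynamicLimit.Theorems.ClampedCorrectorBirth

end
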